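import Mathlib
import Summits.Ventures.PercRepro2.K5StarGenTables

/-!
# THE GENERAL-STAR CERTIFICATES, V′: THE PRODUCTS NESTED AND LAZY
(blind cell PercRepro2, mine-2 g41, 2026-08-29; `proofs/MINE2-GENSTAR.md` §4)

The kernel keeps every evaluated closed subterm, so the thirteen products and twelve partial sums of
`posOn38L` per placement cost ≈ 25 full-size numbers of retained memory.  `posOn38M` / `negOn38M` nest the
products by their first and second factors — `lz a B = if a = 0 then 0 else a * B` never evaluates `B`
when `a` is zero — so a placement retains at most sixteen numbers and a killed first factor costs nothing.
`posOn38M_eq`: they are `posOn38f` / `negOn38f` (`lz_eq`, `prod3_eq`, ring); **`starNonnegGen_of_certM4 / M3 / M0`**.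
Own code; standard axioms.
-/

namespace Summit.Ventures.PercRepro2

open Hub

namespace K5

section Lazy

/-- A lazy product: `B` is evaluated only when `a ≠ 0`. -/
def lz (a B : ℕ) : ℕ := if a = 0 then 0 else a * B

/-- `lz` is the product. -/
lemma lz_eq (a B : ℕ) : lz a B = a * B := by
  unfold lz
  split_ifs with h
  · simp [h]
  · rfl

/-- The positive products at `b = 4` on the literals, nested and lazy. -/
def posOn38M4 (m₁ m₂ m₃ : ℕ) : ℕ :=
  lz (kronL BtPD m₁) (lz (kronL BtQ m₂) (kronL Bt4p_4 m₃ + kronL Bt6m_4 m₃) + lz (kronL Bt7p_4 m₂) (kronL Bt7m_0 m₃ + kronL Bt10p m₃) + lz (kronL Bt7m_4 m₂) (kronL Bt7p_0 m₃ + kronL Bt10m m₃)) +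
    lz (kronL BtQ m₁) (lz (kronL BtPDoU m₂) (kronL Bt5p_4 m₃) + lz (kronL Bt12_4 m₂) (kronL BtPDoU m₃)) +
    lz (kronL BtPDoU m₁) (lz (kronL Bt7p_4 m₂) (kronL Bt7m_3 m₃) + lz (kronL Bt7m_4 m₂) (kronL Bt7p_3 m₃))

/-- `posOn38M4` is `posOn38L4`. -/
lemma posOn38M4_eq (m₁ m₂ m₃ : ℕ) : posOn38M4 m₁ m₂ m₃ = posOn38L4 m₁ m₂ m₃ := by
  unfold posOn38M4 posOn38L4
  simp only [lz_eq, prod3_eq]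
  ring

/-- The negative products at `b = 4` on the literals, nested and lazy. -/
def negOn38M4 (m₁ m₂ m₃ : ℕ) : ℕ :=
  lz (kronL BtPD m₁) (lz (kronL BtQ m₂) (kronL Bt4m_4 m₃ + kronL Bt6p_4 m₃ + kronL Bt11_4 m₃) + lz (kronL Bt7p_4 m₂) (kronL Bt7p_0 m₃ + kronL Bt10m m₃) + lz (kronL Bt7m_4 m₂) (kronL Bt7m_0 m₃ + kronL Bt10p m₃)) +
    lz (kronL BtQ m₁) (lz (kronL BtPDoU m₂) (kronL Bt5m_4 m₃)) +
    lz (kronL BtPDoU m₁) (lz (kronL Bt7p_4 m₂) (kronL Bt7p_3 m₃) + lz (kronL Bt7m_4 m₂) (kronL Bt7m_3 m₃))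

/-- `negOn38M4` is `negOn38L4`. -/
lemma negOn38M4_eq (m₁ m₂ m₃ : ℕ) : negOn38M4 m₁ m₂ m₃ = negOn38L4 m₁ m₂ m₃ := by
  unfold negOn38M4 negOn38L4
  simp only [lz_eq, prod3_eq]
  ring

/-- The positive products at `b = 3` on the literals, nested and lazy. -/
def posOn38M3 (m₁ m₂ m₃ : ℕ) : ℕ :=
  lz (kronL BtPD m₁) (lz (kronL BtQ m₂) (kronL Bt4p_3 m₃ + kronL Bt6m_3 m₃) + lz (kronL Bt7p_3 m₂) (kronL Bt7m_0 m₃ + kronL Bt10p m₃) + lz (kronL Bt7m_3 m₂) (kronL Bt7p_0 m₃ + kronL Bt10m m₃)) +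
    lz (kronL BtQ m₁) (lz (kronL BtPDoU m₂) (kronL Bt5p_3 m₃) + lz (kronL Bt12_3 m₂) (kronL BtPDoU m₃)) +
    lz (kronL BtPDoU m₁) (lz (kronL Bt7p_3 m₂) (kronL Bt7m_3 m₃) + lz (kronL Bt7m_3 m₂) (kronL Bt7p_3 m₃))

/-- `posOn38M3` is `posOn38L3`. -/
lemma posOn38M3_eq (m₁ m₂ m₃ : ℕ) : posOn38M3 m₁ m₂ m₃ = posOn38L3 m₁ m₂ m₃ := by
  unfold posOn38M3 posOn38L3
  simp only [lz_eq, prod3_eq]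
  ring

/-- The negative products at `b = 3` on the literals, nested and lazy. -/
def negOn38M3 (m₁ m₂ m₃ : ℕ) : ℕ :=
  lz (kronL BtPD m₁) (lz (kronL BtQ m₂) (kronL Bt4m_3 m₃ + kronL Bt6p_3 m₃ + kronL Bt11_3 m₃) + lz (kronL Bt7p_3 m₂) (kronL Bt7p_0 m₃ + kronL Bt10m m₃) + lz (kronL Bt7m_3 m₂) (kronL Bt7m_0 m₃ + kronL Bt10p m₃)) +
    lz (kronL BtQ m₁) (lz (kronL BtPDoU m₂) (kronL Bt5m_3 m₃)) +
    lz (kronL BtPDoU m₁) (lz (kronL Bt7p_3 m₂) (kronL Bt7p_3 m₃) + lz (kronL Bt7m_3 m₂) (kronL Bt7m_3 m₃))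

/-- `negOn38M3` is `negOn38L3`. -/
lemma negOn38M3_eq (m₁ m₂ m₃ : ℕ) : negOn38M3 m₁ m₂ m₃ = negOn38L3 m₁ m₂ m₃ := by
  unfold negOn38M3 negOn38L3
  simp only [lz_eq, prod3_eq]
  ring

/-- The positive products at `b = 0` on the literals, nested and lazy. -/
def posOn38M0 (m₁ m₂ m₃ : ℕ) : ℕ :=
  lz (kronL BtPD m₁) (lz (kronL BtQ m₂) (kronL Bt4p_0 m₃ + kronL Bt6m_0 m₃) + lz (kronL Bt7p_0 m₂) (kronL Bt7m_0 m₃ + kronL Bt10p m₃) + lz (kronL Bt7m_0 m₂) (kronL Bt7p_0 m₃ + kronL Bt10m m₃)) +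
    lz (kronL BtQ m₁) (lz (kronL BtPDoU m₂) (kronL Bt5p_0 m₃) + lz (kronL Bt12_0 m₂) (kronL BtPDoU m₃)) +
    lz (kronL BtPDoU m₁) (lz (kronL Bt7p_0 m₂) (kronL Bt7m_3 m₃) + lz (kronL Bt7m_0 m₂) (kronL Bt7p_3 m₃))

/-- `posOn38M0` is `posOn38L0`. -/
lemma posOn38M0_eq (m₁ m₂ m₃ : ℕ) : posOn38M0 m₁ m₂ m₃ = posOn38L0 m₁ m₂ m₃ := by
  unfold posOn38M0 posOn38L0
  simp only [lz_eq, prod3_eq]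
  ring

/-- The negative products at `b = 0` on the literals, nested and lazy. -/
def negOn38M0 (m₁ m₂ m₃ : ℕ) : ℕ :=
  lz (kronL BtPD m₁) (lz (kronL BtQ m₂) (kronL Bt4m_0 m₃ + kronL Bt6p_0 m₃ + kronL Bt11_0 m₃) + lz (kronL Bt7p_0 m₂) (kronL Bt7p_0 m₃ + kronL Bt10m m₃) + lz (kronL Bt7m_0 m₂) (kronL Bt7m_0 m₃ + kronL Bt10p m₃)) +
    lz (kronL BtQ m₁) (lz (kronL BtPDoU m₂) (kronL Bt5m_0 m₃)) +
    lz (kronL BtPDoU m₁) (lz (kronL Bt7p_0 m₂) (kronL Bt7p_3 m₃) + lz (kronL Bt7m_0 m₂) (kronL Bt7m_3 m₃))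

/-- `negOn38M0` is `negOn38L0`. -/
lemma negOn38M0_eq (m₁ m₂ m₃ : ℕ) : negOn38M0 m₁ m₂ m₃ = negOn38L0 m₁ m₂ m₃ := by
  unfold negOn38M0 negOn38L0
  simp only [lz_eq, prod3_eq]
  ring

variable {R : Type*} [Field R] [LinearOrder R] [IsStrictOrderedRing R]

/-- **`StarNonnegGen` at `b = 4` from one certificate on the nested lazy products.** -/
theorem starNonnegGen_of_certM4 (L : List (Fin 5 × ℕ)) (ms : List Mask3) (msI : List (ℕ × ℕ × ℕ))
    (hms : ((placeList L ∅ ∅ ∅).map cmask3).filter alive = ms) (hmsI : ms.map swIdx = msI)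
    (hlen : ms.length ≤ 454) (hc : CertLE8 (sumLI negOn38M4 msI) (sumLI posOn38M4 msI)) :
    StarNonnegGen R 0 1 2 3 4 L := by
  refine starNonnegGen_of_certL4 L ms msI hms hmsI hlen ?_
  rwa [sumLI_congr _ _ (negOn38M4_eq), sumLI_congr _ _ (posOn38M4_eq)] at hc

/-- **`StarNonnegGen` at `b = 3` from one certificate on the nested lazy products.** -/
theorem starNonnegGen_of_certM3 (L : List (Fin 5 × ℕ)) (ms : List Mask3) (msI : List (ℕ × ℕ × ℕ))
    (hms : ((placeList L ∅ ∅ ∅).map cmask3).filter alive = ms) (hmsI : ms.map swIdx = msI)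
    (hlen : ms.length ≤ 454) (hc : CertLE8 (sumLI negOn38M3 msI) (sumLI posOn38M3 msI)) :
    StarNonnegGen R 0 1 2 3 3 L := by
  refine starNonnegGen_of_certL3 L ms msI hms hmsI hlen ?_
  rwa [sumLI_congr _ _ (negOn38M3_eq), sumLI_congr _ _ (posOn38M3_eq)] at hc

/-- **`StarNonnegGen` at `b = 0` from one certificate on the nested lazy products.** -/
theorem starNonnegGen_of_certM0 (L : List (Fin 5 × ℕ)) (ms : List Mask3) (msI : List (ℕ × ℕ × ℕ))
    (hms : ((placeList L ∅ ∅ ∅).map cmask3).filter alive = ms) (hmsI : ms.map swIdx = msI)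
    (hlen : ms.length ≤ 454) (hc : CertLE8 (sumLI negOn38M0 msI) (sumLI posOn38M0 msI)) :
    StarNonnegGen R 0 1 2 3 0 L := by
  refine starNonnegGen_of_certL0 L ms msI hms hmsI hlen ?_
  rwa [sumLI_congr _ _ (negOn38M0_eq), sumLI_congr _ _ (posOn38M0_eq)] at hc

end Lazy

end K5

end Summit.Ventures.PercRepro2
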